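import Mathlib.LinearAlgebra.QuadraticForm.IsometryEquiv
import Literature.AlgebraicGeometry.Motives.FamiliesVHSProofs
import Literature.AlgebraicGeometry.Motives.HodgeStructureK3TypeAdjointProofs
import HarnessLib

/-!
# Integral Hodge classes of bounded norm are finite; generic Hodge classes have finite monodromy orbits

Layer `Literature/AlgebraicGeometry/Motives` (fact seat of
`HodgeTheory.bku_finite_monodromyOrbit_of_isHodgeGenericIn`, Baldi–Klingler–Ullmo 2024 §3.2).
Everything in this file is PROVED; no definition and no named fact is introduced.

The finiteness half of the classical argument (Deligne, *Théorie de Hodge II*, 4.; Cattani–Deligne–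
Kaplan, *On the locus of Hodge classes*, §1; André 1992, §5) that a Hodge class all of whose flat
translates are Hodge classes — a "generic" Hodge class, e.g. every Hodge class at a Hodge-generic
point — has a FINITE orbit under monodromy: the translates are integral, of type `(p,p)`, and of the
same self-intersection `Q(u,u)`, and

* `HodgeStructure.Polarization.form_self_pos_of_mem_hodgeClasses` — a polarization (tree convention
  `i^{p-q} Q(x, x̄) > 0` on `V^{p,q}`, `HodgeStructure.Polarization`) is POSITIVE DEFINITE on the
  rational Hodge classes of type `(p,p)` in weight `2p` (`x = 1 ⊗ v` is real of type `(p,p)`, phase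
  `i⁰ = 1`; Voisin, *Hodge Theory I*, §7.1.2; CDK §1: "`Q(u,u) > 0` for `u` of type `(p,p)`");
* `HodgeStructure.Polarization.finite_mem_hodgeClasses_form_le` — hence **in a polarized Hodge
  structure of weight `2p` the Hodge classes of type `(p,p)` lying in a finitely generated subgroup
  `L ⊆ V` (a lattice) and of self-intersection `Q(v,v) ≤ K` form a finite set** (the fibrewise
  finiteness underlying Cattani–Deligne–Kaplan's `S^{(K)}`; CDK 1995, §1, proof of Thm. 1.1 via 1.5:
  "integral elements of type `(p,p)` and bounded `Q(u,u)` in a fibre are finite in number");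
  the algebra behind it, `finite_mem_of_posDef_of_fg` — vectors of a finitely generated subgroup of
  a `ℚ`-vector space on which a quadratic form is positive definite, of bounded value, are finite —
  is proved over `ℚ` by Sylvester's diagonalisation (Mathlib `QuadraticForm.equivalent_weightedSumSquares`)
  and bounded denominators, without real numbers;
* `VHSData.finite_setOf_isHodgeAt_form_le` — for the hypothesis structure `VHSData` of a polarized
  `ℤ`VHS (`Motives/FamiliesVHS`): at each point `s`, the integral Hodge classes `u ∈ V_ℤ,s` of level
  `p` (weight `2p`) with `Q_s(u,u) ≤ K` are finite in number;
* `VHSData.finite_range_transport_of_forall_isHodgeAt` — **an integral Hodge class all of whose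
  monodromy translates are Hodge classes has finite monodromy orbit** (flatness of `Q` and of `V_ℤ`:
  `VHSData.form_transport_toRat`); `VHSData.finite_range_transport_of_generic` — in particular a
  GENERIC integral Hodge class (Hodge along every path to every point) has finite monodromy orbit.

What is NOT here: that at a Hodge-generic point (Mumford–Tate group of maximal dimension) every Hodge
class is generic (analyticity of Hodge loci, holomorphy of the Hodge filtration — not recorded by
`VHSData`), and the identification of the abstract transport of a `GeometricVHSData` with the flat
continuation in the espace étalé of `R²ᵖ f_* ℂ` (see `HodgeTheory/HodgeGenericQbarDescentProofs`).

## References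

* [CattaniDeligneKaplan1995JAMS] E. Cattani, P. Deligne, A. Kaplan, On the locus of Hodge classes,
  JAMS 8 (1995), §1 (Thm. 1.1, and the reduction "1.5 ⟹ 1.1").
* [VoisinHodgeI2002] C. Voisin, Hodge Theory and Complex Algebraic Geometry I, CUP 2002, §7.1.2 Def. 7.7.
* [BaldiKlinglerUllmo2024] G. Baldi, B. Klingler, E. Ullmo, Invent. Math. 235 (2024), §3.2.
* [Schmid1973] W. Schmid, Invent. Math. 22 (1973), §2 (flat integral structure and polarization).
-/

open scoped TensorProduct

noncomputable section

namespace Literature.AlgebraicGeometry.Motives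

universe u

/-! ### Algebra: vectors of bounded norm in a lattice, for a positive definite rational form -/

section Algebra

/-- **Bounded denominators.** A finitely generated subgroup `N` of `ℚʳ` has bounded denominators:
there is `D ≥ 1` with `D · N ⊆ ℤʳ` (clear the denominators of the finitely many coordinates of a
finite generating set). [folklore] -/
theorem exists_den_of_fg {r : ℕ} (N : Submodule ℤ (Fin r → ℚ)) (hN : N.FG) :
    ∃ D : ℕ, 0 < D ∧ ∀ y ∈ N, ∀ i, ∃ z : ℤ, (D : ℚ) * y i = z := by
  obtain ⟨s, rfl⟩ := hN
  refine ⟨∏ g ∈ s, ∏ i, (g i).den, ?_, fun y hy ↦ ?_⟩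
  · exact Finset.prod_pos fun g _ ↦ Finset.prod_pos fun i _ ↦ (g i).den_pos
  · induction hy using Submodule.span_induction with
    | mem g hg =>
      intro i
      obtain ⟨m, hm⟩ : (g i).den ∣ ∏ g ∈ s, ∏ i, (g i).den :=
        (Finset.dvd_prod_of_mem (fun j ↦ (g j).den) (Finset.mem_univ i)).trans
          (Finset.dvd_prod_of_mem (fun g ↦ ∏ j, (g j).den) hg)
      refine ⟨m * (g i).num, ?_⟩
      rw [hm, Nat.cast_mul, mul_comm ((g i).den : ℚ), mul_assoc, mul_comm ((g i).den : ℚ),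
        Rat.mul_den_eq_num]
      push_cast
      ring
    | zero => exact fun i ↦ ⟨0, by simp⟩
    | add y y' _ _ hy hy' =>
      intro i
      obtain ⟨z, hz⟩ := hy i
      obtain ⟨z', hz'⟩ := hy' i
      exact ⟨z + z', by rw [Pi.add_apply, mul_add, hz, hz']; push_cast; ring⟩
    | smul a y _ hy =>
      intro i
      obtain ⟨z, hz⟩ := hy i
      refine ⟨a * z, ?_⟩
      rw [Pi.smul_apply, zsmul_eq_mul, mul_left_comm, hz]
      push_cast
      ring

/-- **Rational points of bounded weighted norm and bounded denominator are finite**: for positive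
weights `wᵢ`, the `y ∈ ℚʳ` with `Σ wᵢ yᵢ² ≤ K` and `D yᵢ ∈ ℤ` form a finite set (each `D yᵢ` is an
integer of square `≤ D² K / wᵢ`). [folklore] -/
theorem finite_setOf_weightedSum_le {r : ℕ} {w : Fin r → ℚ} (hw : ∀ i, 0 < w i) (K : ℚ) {D : ℕ}
    (hD : 0 < D) :
    {y : Fin r → ℚ | ∑ i, w i * (y i * y i) ≤ K ∧ ∀ i, ∃ z : ℤ, (D : ℚ) * y i = z}.Finite := by
  -- the finite box of integer vectors `|zᵢ| ≤ ⌈D² K / wᵢ⌉`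
  let B : Fin r → ℤ := fun i ↦ ⌈(D : ℚ) ^ 2 * K / w i⌉
  have hbox : (Set.univ.pi fun i ↦ Set.Icc (-B i) (B i)).Finite :=
    Set.Finite.pi fun i ↦ Set.finite_Icc _ _
  refine (hbox.image fun z : Fin r → ℤ ↦ fun i ↦ (z i : ℚ) / D).subset ?_
  rintro y ⟨hyK, hyD⟩
  choose z hz using hyD
  refine ⟨z, fun i _ ↦ ?_, funext fun i ↦ ?_⟩
  · -- `|zᵢ| ≤ zᵢ² = D² yᵢ² ≤ D² K / wᵢ ≤ Bᵢ`
    have hD' : (0 : ℚ) < D := by exact_mod_cast hD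
    have hyi : w i * (y i * y i) ≤ K :=
      (Finset.single_le_sum (fun j _ ↦ mul_nonneg (hw j).le (mul_self_nonneg (y j)))
        (Finset.mem_univ i)).trans hyK
    have hz2 : ((z i : ℤ) : ℚ) ^ 2 ≤ (D : ℚ) ^ 2 * K / w i := by
      rw [le_div_iff₀ (hw i), ← hz]
      nlinarith [hyi, sq_nonneg (D : ℚ)]
    have habs : ((|z i| : ℤ) : ℚ) ≤ (D : ℚ) ^ 2 * K / w i := by
      refine le_trans ?_ hz2
      have h := Int.natAbs_le_self_sq (z i)
      rw [Int.natCast_natAbs] at h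
      exact_mod_cast h
    have hB : |z i| ≤ B i := Int.cast_le.1 (habs.trans (Int.le_ceil _))
    exact Set.mem_Icc.2 (abs_le.1 hB)
  · have hD' : (D : ℚ) ≠ 0 := by exact_mod_cast hD.ne'
    change ((z i : ℤ) : ℚ) / (D : ℚ) = y i
    rw [← hz i, mul_div_cancel_left₀ _ hD']

/-- **Vectors of bounded norm in a lattice are finite.** Let `Q` be a quadratic form on a
finite-dimensional `ℚ`-vector space `W` which is positive definite (`Q x > 0` for `x ≠ 0`) and
`L ⊆ W` a finitely generated subgroup. Then `{x ∈ L | Q x ≤ K}` is finite. Proof over `ℚ`: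
by Sylvester (Mathlib `QuadraticForm.equivalent_weightedSumSquares`) `Q ≅ Σ wᵢ yᵢ²` with
`wᵢ = Q(eᵢ) > 0`; the image of `L` has bounded denominators (`exists_den_of_fg`), and rational points
of bounded weighted norm and denominator are finite (`finite_setOf_weightedSum_le`). [folklore] -/
theorem finite_mem_of_posDef_of_fg {W : Type*} [AddCommGroup W] [Module ℚ W]
    [FiniteDimensional ℚ W] (Q : QuadraticForm ℚ W) (hQ : ∀ x, x ≠ 0 → 0 < Q x)
    (L : Submodule ℤ W) (hL : L.FG) (K : ℚ) :
    {x : W | x ∈ L ∧ Q x ≤ K}.Finite := by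
  haveI : Invertible (2 : ℚ) := invertibleOfNonzero (by norm_num)
  obtain ⟨w, ⟨e⟩⟩ := Q.equivalent_weightedSumSquares
  -- the weights are values of `Q`, hence positive
  have hw : ∀ i, 0 < w i := fun i ↦ by
    have h := e.map_app (e.symm (Pi.single i 1))
    rw [show e (e.symm (Pi.single i 1)) = Pi.single i 1 from e.toLinearEquiv.apply_symm_apply _,
      QuadraticMap.weightedSumSquares_apply, Finset.sum_eq_single i
        (fun j _ hj ↦ by simp [Pi.single_eq_of_ne hj]) (fun h ↦ (h (Finset.mem_univ i)).elim)]
      at h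
    simp only [Pi.single_eq_same, mul_one, smul_eq_mul] at h
    rw [h]
    exact hQ _ fun h0 ↦ by
      have : (Pi.single i (1 : ℚ) : Fin _ → ℚ) = 0 := by
        rw [← e.toLinearEquiv.apply_symm_apply (Pi.single i 1)]
        change e (e.symm (Pi.single i 1)) = 0
        rw [h0, map_zero]
      have h1 := congr_fun this i
      simp only [Pi.single_eq_same, Pi.zero_apply] at h1
      exact one_ne_zero h1
  -- bounded denominators of the image lattice
  obtain ⟨D, hD, hden⟩ := exists_den_of_fg (L.map (e.toLinearEquiv.toLinearMap.restrictScalars ℤ))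
    (hL.map _)
  -- the image of our set lies in the finite set of `finite_setOf_weightedSum_le`
  refine Set.Finite.of_finite_image (f := fun x ↦ (e x : Fin _ → ℚ)) ?_ (e.injective.injOn)
  refine (finite_setOf_weightedSum_le hw K hD).subset ?_
  rintro _ ⟨x, ⟨hxL, hxK⟩, rfl⟩
  refine ⟨?_, hden _ ⟨x, hxL, rfl⟩⟩
  have h := e.map_app x
  rw [QuadraticMap.weightedSumSquares_apply] at h
  simp only [smul_eq_mul] at h
  rw [h]
  exact hxK

end Algebra

/-! ### Polarized Hodge structures: Hodge classes of bounded norm in a lattice are finite -/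

section Hodge

namespace HodgeStructure

variable {V : Type u} [AddCommGroup V] [Module ℚ V] {n : ℤ}

/-- **A polarization is positive definite on rational Hodge classes.** In weight `n = 2p`, for a
non-zero rational class `v` of type `(p,p)` (`v ∈ hodgeClasses p`), `Q(v, v) > 0`: `x = 1 ⊗ v` lies
in `V^{p,p}`, is real, and the second Hodge–Riemann relation reads `i^p (i^p)⁻¹ Q_ℂ(x, x̄) =
Q(v,v) > 0` (Voisin I, §7.1.2, Def. 7.7 (ii); Cattani–Deligne–Kaplan §1). [cite: VoisinHodgeI2002, §7.1.2 Def. 7.7] -/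
theorem Polarization.form_self_pos_of_mem_hodgeClasses {H : HodgeStructure V n} (Q : H.Polarization)
    {p : ℤ} (hp : p + p = n) {v : V} (hv : v ∈ H.hodgeClasses p) (hv0 : v ≠ 0) :
    0 < Q.form v v := by
  have hx : ofRat v ∈ H.piece p p := H.ofRat_mem_piece_of_mem_hodgeClasses hp hv
  have hx0 : ofRat v ≠ 0 := fun h ↦ hv0 (ofRat_injective (by rw [h, map_zero]))
  obtain ⟨r, hr, hQ⟩ := Q.pos p p hp (ofRat v) hx hx0
  rw [mul_inv_cancel₀ (zpow_ne_zero _ Complex.I_ne_zero), one_mul, conj_ofRat, ofRat_apply,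
    LinearMap.BilinForm.baseChange_tmul, mul_one] at hQ
  have h : ((Q.form v v : ℚ) : ℂ) = (r : ℂ) := by
    rw [← hQ, Rat.smul_one_eq_cast]
  have h' : ((Q.form v v : ℚ) : ℝ) = r := by exact_mod_cast h
  have h'' : (0 : ℝ) < (Q.form v v : ℚ) := h' ▸ hr
  exact_mod_cast h''

/-- **Hodge classes of bounded norm in a lattice are finite** (the fibrewise finiteness underlying
Cattani–Deligne–Kaplan's `S^{(K)}`): in a polarized Hodge structure of weight `2p`, for every finitely
generated subgroup `L ⊆ V` and every bound `K`, the set of `v ∈ L` of type `(p,p)` with `Q(v,v) ≤ K`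
is finite — `Q` is positive definite on the rational `(p,p)`-classes
(`form_self_pos_of_mem_hodgeClasses`) and vectors of bounded norm in a lattice are finite
(`finite_mem_of_posDef_of_fg`, applied in the `ℚ`-span of the `(p,p)`-classes of `L`). No
finite-dimensionality of `V` is needed. [cite: CattaniDeligneKaplan1995JAMS, §1 Thm. 1.1] -/
theorem Polarization.finite_mem_hodgeClasses_form_le {H : HodgeStructure V n} (Q : H.Polarization)
    {p : ℤ} (hp : p + p = n) (L : Submodule ℤ V) (hL : L.FG) (K : ℚ) :
    {v : V | v ∈ L ∧ v ∈ H.hodgeClasses p ∧ Q.form v v ≤ K}.Finite := by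
  -- the lattice `LH` of `(p,p)`-classes in `L` is finitely generated (`ℤ` is Noetherian)
  let Hdg : Submodule ℤ V := (H.hodgeClasses p).restrictScalars ℤ
  let LH : Submodule ℤ V := L ⊓ Hdg
  haveI : IsNoetherian ℤ L := isNoetherian_of_fg_of_noetherian _ hL
  have hLH : LH.FG := by
    have h : (Hdg.comap L.subtype).map L.subtype = LH := Submodule.map_comap_subtype L Hdg
    rw [← h]
    exact (IsNoetherian.noetherian _).map _
  haveI : IsNoetherian ℤ LH := isNoetherian_of_fg_of_noetherian _ hLH
  -- its `ℚ`-span `W` is finite-dimensional and consists of `(p,p)`-classes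
  obtain ⟨T, hT⟩ := hLH
  let W : Submodule ℚ V := Submodule.span ℚ (LH : Set V)
  have hWT : W = Submodule.span ℚ (T : Set V) := by
    refine le_antisymm (Submodule.span_le.2 ?_) (Submodule.span_mono ?_)
    · rw [← hT]
      exact (Submodule.span_le_restrictScalars ℤ ℚ (T : Set V))
    · rw [← hT]
      exact Submodule.subset_span
  haveI : FiniteDimensional ℚ W := by
    rw [hWT]
    exact FiniteDimensional.span_of_finite ℚ T.finite_toSet
  have hWle : W ≤ H.hodgeClasses p := Submodule.span_le.2 fun v hv ↦ hv.2
  -- `Q` restricted to `W` is a positive definite quadratic form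
  let QW : QuadraticForm ℚ W := (Q.form.restrict W).toQuadraticMap
  have hQW_apply : ∀ x : W, QW x = Q.form x x := fun x ↦ rfl
  have hQW : ∀ x : W, x ≠ 0 → 0 < QW x := fun x hx ↦ by
    rw [hQW_apply]
    exact Q.form_self_pos_of_mem_hodgeClasses hp (hWle x.2) fun h ↦ hx (Subtype.ext h)
  -- the lattice `LH` seen in `W` is finitely generated
  let LW : Submodule ℤ W := LH.comap (W.subtype.restrictScalars ℤ)
  have hLW : LW.FG := by
    rw [← Module.Finite.iff_fg]
    refine Module.Finite.of_injective
      ((W.subtype.restrictScalars ℤ).restrict (p := LW) (q := LH) fun x hx ↦ hx) ?_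
    intro x y hxy
    apply Subtype.ext
    apply Subtype.ext
    exact congrArg (fun z : LH ↦ (z : V)) hxy
  -- conclude: our set is the image of `{x ∈ LW | QW x ≤ K}`
  refine ((finite_mem_of_posDef_of_fg QW hQW LW hLW K).image Subtype.val).subset ?_
  rintro v ⟨hvL, hvH, hvK⟩
  have hvLH : v ∈ LH := ⟨hvL, hvH⟩
  refine ⟨⟨v, Submodule.subset_span hvLH⟩, ⟨?_, ?_⟩, rfl⟩
  · exact hvLH
  · rw [hQW_apply]
    exact hvK

end HodgeStructure

end Hodge

/-! ### Variations: integral Hodge classes of bounded norm; finite monodromy orbits of generic classes -/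

section VHS

namespace VHSData

variable {S : Type} [TopologicalSpace S] {n : ℤ} (D : VHSData S n)

/-- **Integral Hodge classes of bounded self-intersection are finite in each fibre** (the fibrewise
finiteness in Cattani–Deligne–Kaplan's theorem on `S^{(K)}`): for the data `D` of a polarized
`ℤ`VHS of weight `2p`, a point `s` and a bound `K`, the set of `u ∈ V_ℤ,s` which are Hodge classes
of level `p` with `Q_s(u,u) ≤ K` is finite (`V_ℤ,s` is finitely generated, `V_ℤ,s → V_s` is
injective, and `Polarization.finite_mem_hodgeClasses_form_le`). [cite: CattaniDeligneKaplan1995JAMS, §1 Thm. 1.1] -/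
theorem finite_setOf_isHodgeAt_form_le {p : ℤ} (hp : p + p = n) (s : S) (K : ℚ) :
    {u : D.VZ.fiber s | D.IsHodgeAt s p u ∧
      (D.form s).form (D.toRat s u) (D.toRat s u) ≤ K}.Finite := by
  -- a finite generating set `T` of `V_ℤ,s`; the lattice `L = ℤ · toRat(T) ⊆ V_s` contains `im toRat`
  haveI := D.finite s
  obtain ⟨T, hT⟩ := Module.Finite.fg_top (R := ℤ) (M := D.VZ.fiber s)
  let L : Submodule ℤ (D.V.fiber s) := Submodule.span ℤ (D.toRat s '' (T : Set (D.VZ.fiber s)))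
  have hL : L.FG := Submodule.fg_span (T.finite_toSet.image _)
  have hmem : ∀ u : D.VZ.fiber s, D.toRat s u ∈ L := fun u ↦ by
    have hu : u ∈ Submodule.span ℤ (T : Set (D.VZ.fiber s)) := by rw [hT]; trivial
    induction hu using Submodule.span_induction with
    | mem x hx => exact Submodule.subset_span ⟨x, hx, rfl⟩
    | zero => rw [map_zero]; exact zero_mem _
    | add x y _ _ hx hy => rw [map_add]; exact add_mem hx hy
    | smul a x _ hx =>
      -- the `ℤ`-action of the `ModuleCat ℤ` structure on `V_ℤ,s` is the additive one
      -- (`int_smul_eq_zsmul`), so `toRat (a • x) = a • toRat x`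
      convert L.smul_mem a hx using 2
      exact (congrArg (D.toRat s) (int_smul_eq_zsmul _ a x)).trans (map_zsmul (D.toRat s) a x)
  have hfin := (D.form s).finite_mem_hodgeClasses_form_le hp L hL K
  refine Set.Finite.of_finite_image (hfin.subset ?_) (D.toRat_injective_holds s).injOn
  rintro _ ⟨u, ⟨hu, huK⟩, rfl⟩
  exact ⟨hmem u, hu, huK⟩

/-- **An integral Hodge class all of whose monodromy translates are Hodge classes has finite
monodromy orbit**: the translates `γ_* u`, `γ ∈ π₁(S, s)`, are integral Hodge classes of level `p`
with the same self-intersection `Q_s(γ_* u, γ_* u) = Q_s(u, u)` (flatness of `Q` and of `V_ℤ`,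
`form_transport_toRat`), a finite set by `finite_setOf_isHodgeAt_form_le`. This is the finiteness
step of the classical argument that Hodge classes at Hodge-generic points — where every Hodge class
is generic — have finite monodromy orbits (Baldi–Klingler–Ullmo §3.2 via André 1992;
Cattani–Deligne–Kaplan §1). [cite: CattaniDeligneKaplan1995JAMS, §1] [cite: BaldiKlinglerUllmo2024, §3.2] -/
theorem finite_range_transport_of_forall_isHodgeAt {p : ℤ} (hp : p + p = n) {s : S}
    {u : D.VZ.fiber s}
    (hu : ∀ γ : Path.Homotopic.Quotient s s, D.IsHodgeAt s p (D.VZ.transport γ u)) :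
    (Set.range fun γ : Path.Homotopic.Quotient s s ↦ D.VZ.transport γ u).Finite := by
  refine (D.finite_setOf_isHodgeAt_form_le hp s
    ((D.form s).form (D.toRat s u) (D.toRat s u))).subset ?_
  rintro _ ⟨γ, rfl⟩
  exact ⟨hu γ, (D.form_transport_toRat γ u).le⟩

/-- The same orbit written with the monodromy representation `ρ : π₁(S, s) → GL(V_ℤ,s)` of the
integral local system. [cite: CattaniDeligneKaplan1995JAMS, §1] -/
theorem finite_range_monodromyRep_of_forall_isHodgeAt {p : ℤ} (hp : p + p = n) {s : S}
    {u : D.VZ.fiber s}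
    (hu : ∀ γ : Path.Homotopic.Quotient s s, D.IsHodgeAt s p (D.VZ.transport γ u)) :
    (Set.range fun γ : FundamentalGroup S s ↦ D.VZ.monodromyRep s γ u).Finite :=
  D.finite_range_transport_of_forall_isHodgeAt hp hu

/-- **A generic integral Hodge class has finite monodromy orbit**: if the flat transport of
`u ∈ V_ℤ,s` along every path to every point `t` is a Hodge class of level `p` at `t` ("`u` remains of
type `(p,p)` everywhere", the generic Hodge classes — at a Hodge-generic point of an honest polarized
`ℤ`VHS every Hodge class is of this kind), then the orbit of `u` under `π₁(S, s)` is finite.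
[cite: CattaniDeligneKaplan1995JAMS, §1] [cite: BaldiKlinglerUllmo2024, §3.2] -/
theorem finite_range_transport_of_generic {p : ℤ} (hp : p + p = n) {s : S} {u : D.VZ.fiber s}
    (hu : ∀ (t : S) (γ : Path.Homotopic.Quotient s t), D.IsHodgeAt t p (D.VZ.transport γ u)) :
    (Set.range fun γ : Path.Homotopic.Quotient s s ↦ D.VZ.transport γ u).Finite :=
  D.finite_range_transport_of_forall_isHodgeAt hp (hu s)

end VHSData

end VHS

end Literature.AlgebraicGeometry.Motives

end
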